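import Literature.Analysis.FluidPDE.KwonKernelOperators
import Literature.Analysis.FluidPDE.KwonLocalLerayDuality
import Literature.Analysis.FluidPDE.PineauVicolEnstrophyIdentity
import HarnessLib

/-!
# Kwon's commutator fields: the `∇φ`-terms of `∂ₐζ_ξ` and `Δζ_ξ` as kernel operators, transposed
# onto the test field

Analysis/FluidPDE file on the discharge path of the named fact
`Literature.Analysis.FluidPDE.kwon2023_velocity_epsilon_regularity`
(`PressureFreeEpsilonRegularity.lean`; H. Kwon, J. Differential Equations (2023) =
arXiv:2104.03160, Thm. 1.4), sixth brick of Lemma 2.5. Testing Navier–Stokes on `Q₂` with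
`Z = ζ_{ξ(t,·)}` (proof of Lemma 2.5, arXiv p. 8) and moving `Δ` and `(u·∇)` back onto `ξ`
produces, besides `ζ_{Δξ}` and `ζ_{∂ₐξ}` (handled by the duality identity), the commutator terms
of `KwonTestFieldCalculus`: `curl((∂ₐφ) curl A_ξ)` and `curl W_ξ`,
`W_ξ = 2 D(curl A_ξ)(∇φ) + (Δφ) curl A_ξ`. They are carried by the shell `5/4 ≤ |x| ≤ 7/4` where
`A_ξ = k ⋆ ξ` with the smooth annular kernel `k` (kernel swap, `KwonTestField`), hence are
`curl (T_K ξ)` for the kernel operators of `KwonKernelOperators` with the explicit smooth,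
compactly supported, operator-valued kernels

* `Kwon2023.commKernelDir a x y = ∂ₐφ(x) (∇k(x − y) × ·)` — `T_{K_a} ξ = (∂ₐφ) curl A_ξ`
  (`kernelIntegralOp_commKernelDir`);
* `Kwon2023.commKernelLap x y = Σᵢ 2∂ᵢφ(x) (∇(∂ᵢk)(x − y) × ·) + Δφ(x) (∇k(x − y) × ·)` —
  `T_{K_Δ} ξ = W_ξ` (`kernelIntegralOp_commKernelLap`: on the shell `D(curl A_ξ) = D(curl(k ⋆ ξ))`
  by the eventual equality `A_ξ = k ⋆ ξ`, `∂ᵢ curl(k ⋆ ξ) = curl(∂ᵢk ⋆ ξ)` and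
  `curl(∂ᵢk ⋆ ξ)(x) = ∫ ∇(∂ᵢk)(x − y) × ξ(y) dy`; off the shell both sides vanish),

and consequently, for every `u ∈ L¹(ℝ³; ℝ³)` and `ξ ∈ C^∞` supported in `B̄(0, r)`, `r < 1`,

* `integral_inner_curl_commDir`: `∫ ⟪u, curl((∂ₐφ) curl A_ξ)⟫ = ∫ ⟪T'_{K_a} u, ξ⟫`,
* `integral_inner_curl_commLap`: `∫ ⟪u, curl W_ξ⟫ = ∫ ⟪T'_{K_Δ} u, ξ⟫`,

with the transposes `T'_K u (y) = ∫ 𝔠_K(x, y)ᵀ u(x) dx` of `KwonKernelOperators` — explicit fields,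
bounded by `sup ‖𝔠_K‖ · ‖u‖_{L¹}` and continuous (`norm_curlKernelTranspose_le`,
`continuous_curlKernelTranspose`): these are Kwon's force terms
`2 curl Δ⁻¹ div(curl u ⊗ ∇φ) − curl Δ⁻¹(Δφ curl u)` ((err.Deu)) and the `∇φ`-part of
`−curl Δ⁻¹(∇φ × (ω × u))`, estimated "similar to (with.naph)" by `‖u‖_{L¹(B₂)}`
(resp. `‖u‖²_{L²(B₂)}` when applied to `uₐu`). The commutator terms vanish off the shell
(`curl_commDir/commLap_eq_zero_of_not_shell`), so the pairings only see `u` on `B₂`.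

Also: `∂ₐφ = 0`, `Δφ = 0` off the shell; the directional derivatives `∂ₐk`
(`Kwon2023.annularKernelDeriv`) of the annular kernel (smooth, supported in `B̄(0,4)`).

## Mathlib / tree search

Tree (reused): `Kwon2023.kernelIntegralOp`, `curlKernelTranspose`,
`integral_inner_curl_kernelIntegralOp`, `curl_kernelIntegralOp_eq_zero` (`KwonKernelOperators`);
`curl_testPotential_eq`, `testPotential_eventuallyEq`, `gradient_eq_sum_fderiv_single`
(`KwonTestField`); `gradient_kwonCutoff_eq_zero_of_lt/gt`, `contDiff_annularKernel`,
`tsupport_annularKernel_subset`, `hasCompactSupport_annularKernel` (`KwonHarmonicPart`);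
`curl_convolution_lsmul_eq_integral_cross_of_locallyIntegrable`, `continuous_cross_of`,
`hasCompactSupport_of_tsupport_subset_closedBall` (`KwonLocalLerayDuality`);
`fderiv_convolution_lsmul_apply` (`HelmholtzAnnihilator`), `curl_fderiv_apply`, `crossCLM(_apply)`,
`radialCutoff_eventuallyEq_one/zero`, `gradient_eq_zero_of_notMem_tsupport` (`WholeSpaceIBP`).
Mathlib: `InnerProductSpace.laplacian_congr_nhds`, `laplacian_const`,
`HasCompactSupport.contDiff_convolution_left`, `Filter.EventuallyEq.fderiv(_eq)`,
`notMem_tsupport_iff_eventuallyEq`; `contDiff_gradient_of_contDiff` (`PineauVicolEnstrophyIdentity`,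
imported for it after a `dedup.landed` preflight).

## References

* H. Kwon, J. Differential Equations (2023) = arXiv:2104.03160: proof of Lemma 2.5 (arXiv p. 8),
  (err.Deu), (est.fd), Remark 2.2 (with.naph). [Kwon2023RolePressure]
-/

noncomputable section

open MeasureTheory Set Function Filter Topology TopologicalSpace Metric InnerProductSpace
  ContinuousLinearMap
open scoped NNReal ENNReal RealInnerProductSpace Convolution Laplacian ContDiff

namespace Literature.Analysis.FluidPDE

namespace Kwon2023

/-! ### The cut-off off the shell `5/4 ≤ |x| ≤ 7/4` -/

/-- `∂ₐφ(x) = 0` for `|x| < 5/4`. [folklore] -/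
theorem fderiv_kwonCutoff_eq_zero_of_lt {x : EuclideanSpace ℝ (Fin 3)} (hx : ‖x‖ < 5 / 4)
    (a : EuclideanSpace ℝ (Fin 3)) : fderiv ℝ kwonCutoff x a = 0 := by
  rw [← FluidPDE.inner_gradient_left kwonCutoff x a, gradient_kwonCutoff_eq_zero_of_lt hx,
    inner_zero_left]

/-- `∂ₐφ(x) = 0` for `|x| > 7/4`. [folklore] -/
theorem fderiv_kwonCutoff_eq_zero_of_gt {x : EuclideanSpace ℝ (Fin 3)} (hx : 7 / 4 < ‖x‖)
    (a : EuclideanSpace ℝ (Fin 3)) : fderiv ℝ kwonCutoff x a = 0 := by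
  rw [← FluidPDE.inner_gradient_left kwonCutoff x a, gradient_kwonCutoff_eq_zero_of_gt hx,
    inner_zero_left]

/-- `Δφ(x) = 0` for `|x| < 5/4` (`φ = 1` near `x`). [folklore] -/
theorem laplacian_kwonCutoff_eq_zero_of_lt {x : EuclideanSpace ℝ (Fin 3)} (hx : ‖x‖ < 5 / 4) :
    (Δ kwonCutoff) x = 0 := by
  have h : kwonCutoff =ᶠ[𝓝 x] fun _ => (1 : ℝ) :=
    radialCutoff_eventuallyEq_one (E := EuclideanSpace ℝ (Fin 3)) (by norm_num) (by norm_num) hx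
  rw [(laplacian_congr_nhds h).eq_of_nhds, InnerProductSpace.laplacian_const, Pi.zero_apply]

/-- `Δφ(x) = 0` for `|x| > 7/4` (`φ = 0` near `x`). [folklore] -/
theorem laplacian_kwonCutoff_eq_zero_of_gt {x : EuclideanSpace ℝ (Fin 3)} (hx : 7 / 4 < ‖x‖) :
    (Δ kwonCutoff) x = 0 := by
  have h : kwonCutoff =ᶠ[𝓝 x] fun _ => (0 : ℝ) :=
    radialCutoff_eventuallyEq_zero (E := EuclideanSpace ℝ (Fin 3)) (by norm_num) (by norm_num) hx
  rw [(laplacian_congr_nhds h).eq_of_nhds, InnerProductSpace.laplacian_const, Pi.zero_apply]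

/-- If `∂ₐφ(x) ≠ 0` then `x` lies in the shell `5/4 ≤ |x| ≤ 7/4`. [folklore] -/
theorem shell_of_fderiv_kwonCutoff_ne_zero {x a : EuclideanSpace ℝ (Fin 3)}
    (h : fderiv ℝ kwonCutoff x a ≠ 0) : 5 / 4 ≤ ‖x‖ ∧ ‖x‖ ≤ 7 / 4 := by
  constructor
  · by_contra h'; exact h (fderiv_kwonCutoff_eq_zero_of_lt (not_le.1 h') a)
  · by_contra h'; exact h (fderiv_kwonCutoff_eq_zero_of_gt (not_le.1 h') a)

/-! ### The directional derivatives of the annular kernel as kernels -/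

variable (a : EuclideanSpace ℝ (Fin 3)) in
/-- The directional derivative `∂ₐk` of the annular kernel. [folklore] -/
def annularKernelDeriv (z : EuclideanSpace ℝ (Fin 3)) : ℝ := fderiv ℝ annularKernel z a

/-- `∂ₐk` is smooth. [folklore] -/
theorem contDiff_annularKernelDeriv (a : EuclideanSpace ℝ (Fin 3)) {n : ℕ∞} :
    ContDiff ℝ n (annularKernelDeriv a) :=
  ((contDiff_annularKernel (n := n + 1)).fderiv_right (m := n) le_rfl).clm_apply contDiff_const

/-- `∂ₐk` has compact support. [folklore] -/
theorem hasCompactSupport_annularKernelDeriv (a : EuclideanSpace ℝ (Fin 3)) :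
    HasCompactSupport (annularKernelDeriv a) :=
  hasCompactSupport_annularKernel.fderiv_apply (𝕜 := ℝ) a

/-- `∇k(z) = 0` for `|z| > 4`. [folklore] -/
theorem gradient_annularKernel_eq_zero {z : EuclideanSpace ℝ (Fin 3)} (hz : 4 < ‖z‖) :
    gradient annularKernel z = 0 :=
  gradient_eq_zero_of_notMem_tsupport fun h => by
    have := mem_closedBall_zero_iff.1 (tsupport_annularKernel_subset h); linarith

/-- `tsupport ∂ₐk ⊆ B̄(0, 4)`. [folklore] -/
theorem tsupport_annularKernelDeriv_subset (a : EuclideanSpace ℝ (Fin 3)) :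
    tsupport (annularKernelDeriv a) ⊆ closedBall (0 : EuclideanSpace ℝ (Fin 3)) 4 :=
  (tsupport_fderiv_apply_subset ℝ a).trans tsupport_annularKernel_subset

/-- `∇(∂ₐk)(z) = 0` for `|z| > 4`. [folklore] -/
theorem gradient_annularKernelDeriv_eq_zero (a : EuclideanSpace ℝ (Fin 3))
    {z : EuclideanSpace ℝ (Fin 3)} (hz : 4 < ‖z‖) : gradient (annularKernelDeriv a) z = 0 :=
  gradient_eq_zero_of_notMem_tsupport fun h => by
    have := mem_closedBall_zero_iff.1 (tsupport_annularKernelDeriv_subset a h); linarith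

/-! ### The kernels of the two commutators -/

/-- `c • T = 0` for `c = 0` (operators on `ℝ³`; by extensionality, to stay clear of the scalar
tower on `L(ℝ³)`). [folklore] -/
theorem smul_clm_eq_zero_of_eq_zero {c : ℝ} (hc : c = 0)
    (T : EuclideanSpace ℝ (Fin 3) →L[ℝ] EuclideanSpace ℝ (Fin 3)) : c • T = 0 := by
  ext v
  simp [hc]

/-- `c • crossCLM 0 = 0`. [folklore] -/
theorem smul_crossCLM_zero (c : ℝ) : c • crossCLM (0 : EuclideanSpace ℝ (Fin 3)) = 0 := by
  ext v
  simp


variable (a : EuclideanSpace ℝ (Fin 3)) in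
/-- **Kernel of the `∂ₐ`-commutator**: `K_a(x, y) = ∂ₐφ(x) (∇k(x − y) × ·)`, so that
`T_{K_a} ξ = (∂ₐφ) curl A_ξ` (the `∇φ`-term of `∂ₐζ_ξ = ζ_{∂ₐξ} − curl((∂ₐφ) curl A_ξ)`).
[cite: Kwon2023RolePressure, Lemma 2.5 (proof, p. 8)] -/
def commKernelDir (x y : EuclideanSpace ℝ (Fin 3)) :
    EuclideanSpace ℝ (Fin 3) →L[ℝ] EuclideanSpace ℝ (Fin 3) :=
  (fderiv ℝ kwonCutoff x a) • crossCLM (gradient annularKernel (x - y))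

/-- **Kernel of the `Δ`-commutator**:
`K_Δ(x, y) = Σᵢ 2∂ᵢφ(x) (∇(∂ᵢk)(x − y) × ·) + Δφ(x) (∇k(x − y) × ·)`, so that
`T_{K_Δ} ξ = 2 D(curl A_ξ)(∇φ) + (Δφ) curl A_ξ =: W_ξ` (the `∇φ, Δφ`-term of
`Δζ_ξ = ζ_{Δξ} − curl W_ξ`; Kwon's (err.Deu)). [cite: Kwon2023RolePressure, (err.Deu)] -/
def commKernelLap (x y : EuclideanSpace ℝ (Fin 3)) :
    EuclideanSpace ℝ (Fin 3) →L[ℝ] EuclideanSpace ℝ (Fin 3) :=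
  ∑ i, (2 * fderiv ℝ kwonCutoff x (EuclideanSpace.single (i : Fin 3) (1 : ℝ))) •
      crossCLM (gradient (annularKernelDeriv (EuclideanSpace.single (i : Fin 3) (1 : ℝ))) (x - y))
    + ((Δ kwonCutoff) x) • crossCLM (gradient annularKernel (x - y))

/-- `K_a` is jointly smooth. [folklore] -/
theorem contDiff_uncurry_commKernelDir (a : EuclideanSpace ℝ (Fin 3)) {n : ℕ∞} :
    ContDiff ℝ n (uncurry (commKernelDir a)) := by
  have h1 : ContDiff ℝ n fun p : EuclideanSpace ℝ (Fin 3) × EuclideanSpace ℝ (Fin 3) =>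
      fderiv ℝ kwonCutoff p.1 a :=
    (((contDiff_kwonCutoff (n := n + 1)).fderiv_right (m := n) le_rfl).clm_apply
      contDiff_const).comp contDiff_fst
  have h2 : ContDiff ℝ n fun p : EuclideanSpace ℝ (Fin 3) × EuclideanSpace ℝ (Fin 3) =>
      crossCLM (gradient annularKernel (p.1 - p.2)) :=
    crossCLM.contDiff.comp ((contDiff_gradient_of_contDiff (contDiff_annularKernel (n := n + 1))).comp
      (contDiff_fst.sub contDiff_snd))
  exact h1.smul h2

/-- `K_Δ` is jointly smooth. [folklore] -/
theorem contDiff_uncurry_commKernelLap {n : ℕ∞} : ContDiff ℝ n (uncurry commKernelLap) := by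
  have h1 : ∀ i : Fin 3, ContDiff ℝ n fun p : EuclideanSpace ℝ (Fin 3) × EuclideanSpace ℝ (Fin 3) =>
      (2 * fderiv ℝ kwonCutoff p.1 (EuclideanSpace.single i (1 : ℝ))) •
        crossCLM (gradient (annularKernelDeriv (EuclideanSpace.single i (1 : ℝ))) (p.1 - p.2)) :=
    fun i => by
    refine (contDiff_const.mul ((((contDiff_kwonCutoff (n := n + 1)).fderiv_right (m := n)
      le_rfl).clm_apply contDiff_const).comp contDiff_fst)).smul ?_
    exact crossCLM.contDiff.comp ((contDiff_gradient_of_contDiff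
      (contDiff_annularKernelDeriv _ (n := n + 1))).comp (contDiff_fst.sub contDiff_snd))
  have h2 : ContDiff ℝ n fun p : EuclideanSpace ℝ (Fin 3) × EuclideanSpace ℝ (Fin 3) =>
      ((Δ kwonCutoff) p.1) • crossCLM (gradient annularKernel (p.1 - p.2)) :=
    ((contDiff_laplacian (n := n) (contDiff_kwonCutoff (n := n + 2))).comp contDiff_fst).smul
      (crossCLM.contDiff.comp ((contDiff_gradient_of_contDiff (contDiff_annularKernel (n := n + 1))).comp
        (contDiff_fst.sub contDiff_snd)))
  have e : uncurry commKernelLap = fun p : EuclideanSpace ℝ (Fin 3) × EuclideanSpace ℝ (Fin 3) =>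
      (∑ i, (2 * fderiv ℝ kwonCutoff p.1 (EuclideanSpace.single i (1 : ℝ))) •
        crossCLM (gradient (annularKernelDeriv (EuclideanSpace.single i (1 : ℝ))) (p.1 - p.2)))
      + ((Δ kwonCutoff) p.1) • crossCLM (gradient annularKernel (p.1 - p.2)) := by
    funext p; rfl
  rw [e]
  exact (ContDiff.sum fun i _ => h1 i).add h2

/-- `K_a(x, y) = 0` unless `5/4 ≤ |x| ≤ 7/4`. [folklore] -/
theorem commKernelDir_eq_zero_of_not_shell (a : EuclideanSpace ℝ (Fin 3))
    {x : EuclideanSpace ℝ (Fin 3)} (hx : ‖x‖ < 5 / 4 ∨ 7 / 4 < ‖x‖) (y : EuclideanSpace ℝ (Fin 3)) :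
    commKernelDir a x y = 0 := by
  rcases hx with hx | hx
  · exact smul_clm_eq_zero_of_eq_zero (fderiv_kwonCutoff_eq_zero_of_lt hx a) _
  · exact smul_clm_eq_zero_of_eq_zero (fderiv_kwonCutoff_eq_zero_of_gt hx a) _

/-- `K_Δ(x, y) = 0` unless `5/4 ≤ |x| ≤ 7/4`. [folklore] -/
theorem commKernelLap_eq_zero_of_not_shell
    {x : EuclideanSpace ℝ (Fin 3)} (hx : ‖x‖ < 5 / 4 ∨ 7 / 4 < ‖x‖) (y : EuclideanSpace ℝ (Fin 3)) :
    commKernelLap x y = 0 := by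
  have hf : ∀ b, fderiv ℝ kwonCutoff x b = 0 := fun b => by
    rcases hx with hx | hx
    · exact fderiv_kwonCutoff_eq_zero_of_lt hx b
    · exact fderiv_kwonCutoff_eq_zero_of_gt hx b
  have hl : (Δ kwonCutoff) x = 0 := by
    rcases hx with hx | hx
    · exact laplacian_kwonCutoff_eq_zero_of_lt hx
    · exact laplacian_kwonCutoff_eq_zero_of_gt hx
  rw [commKernelLap, Finset.sum_eq_zero fun i _ => smul_clm_eq_zero_of_eq_zero (by rw [hf, mul_zero]) _,
    smul_clm_eq_zero_of_eq_zero hl _, add_zero]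

/-- `K_a(x, y) = 0` for `|y| > 23/4` (then `|x − y| > 4` whenever `|x| ≤ 7/4`). [folklore] -/
theorem commKernelDir_eq_zero_of_far (a : EuclideanSpace ℝ (Fin 3))
    {x y : EuclideanSpace ℝ (Fin 3)} (hy : 23 / 4 < ‖y‖) : commKernelDir a x y = 0 := by
  by_cases hx : 7 / 4 < ‖x‖
  · exact commKernelDir_eq_zero_of_not_shell a (Or.inr hx) y
  · have h : 4 < ‖x - y‖ := by
      have := norm_sub_norm_le y x
      rw [norm_sub_rev] at this
      linarith [not_lt.1 hx]
    rw [commKernelDir, gradient_annularKernel_eq_zero h, smul_crossCLM_zero]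

/-- `K_Δ(x, y) = 0` for `|y| > 23/4`. [folklore] -/
theorem commKernelLap_eq_zero_of_far
    {x y : EuclideanSpace ℝ (Fin 3)} (hy : 23 / 4 < ‖y‖) : commKernelLap x y = 0 := by
  by_cases hx : 7 / 4 < ‖x‖
  · exact commKernelLap_eq_zero_of_not_shell (Or.inr hx) y
  · have h : 4 < ‖x - y‖ := by
      have := norm_sub_norm_le y x
      rw [norm_sub_rev] at this
      linarith [not_lt.1 hx]
    rw [commKernelLap, gradient_annularKernel_eq_zero h, smul_crossCLM_zero, add_zero]
    refine Finset.sum_eq_zero fun i _ => ?_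
    rw [gradient_annularKernelDeriv_eq_zero _ h, smul_crossCLM_zero]

/-- `K_a` has compact support in `(x, y)`. [folklore] -/
theorem hasCompactSupport_uncurry_commKernelDir (a : EuclideanSpace ℝ (Fin 3)) :
    HasCompactSupport (uncurry (commKernelDir a)) := by
  refine HasCompactSupport.intro ((isCompact_closedBall (0 : EuclideanSpace ℝ (Fin 3)) (7 / 4)).prod
    (isCompact_closedBall (0 : EuclideanSpace ℝ (Fin 3)) (23 / 4))) fun p hp => ?_
  rw [mem_prod, mem_closedBall_zero_iff, mem_closedBall_zero_iff, not_and_or, not_le, not_le] at hp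
  rcases hp with hp | hp
  · exact commKernelDir_eq_zero_of_not_shell a (Or.inr hp) p.2
  · exact commKernelDir_eq_zero_of_far a hp

/-- `K_Δ` has compact support in `(x, y)`. [folklore] -/
theorem hasCompactSupport_uncurry_commKernelLap : HasCompactSupport (uncurry commKernelLap) := by
  refine HasCompactSupport.intro ((isCompact_closedBall (0 : EuclideanSpace ℝ (Fin 3)) (7 / 4)).prod
    (isCompact_closedBall (0 : EuclideanSpace ℝ (Fin 3)) (23 / 4))) fun p hp => ?_
  rw [mem_prod, mem_closedBall_zero_iff, mem_closedBall_zero_iff, not_and_or, not_le, not_le] at hp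
  rcases hp with hp | hp
  · exact commKernelLap_eq_zero_of_not_shell (Or.inr hp) p.2
  · exact commKernelLap_eq_zero_of_far hp

/-- Off the shell in `x`, `(x, y)` is not in the topological support of `K_a`. [folklore] -/
theorem notMem_tsupport_commKernelDir (a : EuclideanSpace ℝ (Fin 3))
    {x : EuclideanSpace ℝ (Fin 3)} (hx : ‖x‖ < 5 / 4 ∨ 7 / 4 < ‖x‖) (y : EuclideanSpace ℝ (Fin 3)) :
    (x, y) ∉ tsupport (uncurry (commKernelDir a)) := by
  have ho : IsOpen {p : EuclideanSpace ℝ (Fin 3) × EuclideanSpace ℝ (Fin 3) |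
      ‖p.1‖ < 5 / 4 ∨ 7 / 4 < ‖p.1‖} :=
    (isOpen_lt (continuous_norm.comp continuous_fst) continuous_const).union
      (isOpen_lt continuous_const (continuous_norm.comp continuous_fst))
  rw [notMem_tsupport_iff_eventuallyEq]
  filter_upwards [ho.mem_nhds (show (x, y) ∈ {p : EuclideanSpace ℝ (Fin 3) × EuclideanSpace ℝ (Fin 3) |
      ‖p.1‖ < 5 / 4 ∨ 7 / 4 < ‖p.1‖} from hx)] with p hp
  exact commKernelDir_eq_zero_of_not_shell a hp p.2

/-- Off the shell in `x`, `(x, y)` is not in the topological support of `K_Δ`. [folklore] -/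
theorem notMem_tsupport_commKernelLap
    {x : EuclideanSpace ℝ (Fin 3)} (hx : ‖x‖ < 5 / 4 ∨ 7 / 4 < ‖x‖) (y : EuclideanSpace ℝ (Fin 3)) :
    (x, y) ∉ tsupport (uncurry commKernelLap) := by
  have ho : IsOpen {p : EuclideanSpace ℝ (Fin 3) × EuclideanSpace ℝ (Fin 3) |
      ‖p.1‖ < 5 / 4 ∨ 7 / 4 < ‖p.1‖} :=
    (isOpen_lt (continuous_norm.comp continuous_fst) continuous_const).union
      (isOpen_lt continuous_const (continuous_norm.comp continuous_fst))
  rw [notMem_tsupport_iff_eventuallyEq]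
  filter_upwards [ho.mem_nhds (show (x, y) ∈ {p : EuclideanSpace ℝ (Fin 3) × EuclideanSpace ℝ (Fin 3) |
      ‖p.1‖ < 5 / 4 ∨ 7 / 4 < ‖p.1‖} from hx)] with p hp
  exact commKernelLap_eq_zero_of_not_shell hp p.2

/-! ### Identification of the commutator terms with the kernel operators -/

section Identification

variable {ξ u : EuclideanSpace ℝ (Fin 3) → EuclideanSpace ℝ (Fin 3)} {r : ℝ}

/-- `curl (k ⋆ ξ)(x) = ∫ ∇k(x − y) × ξ(y) dy` for the annular kernel. [folklore] -/
theorem curl_annularKernel_convolution_eq (hξ : Continuous ξ) (x : EuclideanSpace ℝ (Fin 3)) :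
    curl (annularKernel ⋆[lsmul ℝ ℝ, volume] ξ) x =
      ∫ y, cross (gradient annularKernel (x - y)) (ξ y) :=
  curl_convolution_lsmul_eq_integral_cross_of_locallyIntegrable (contDiff_annularKernel (n := 1))
    hasCompactSupport_annularKernel hξ.locallyIntegrable x

/-- `curl (∂ₐk ⋆ ξ)(x) = ∫ ∇(∂ₐk)(x − y) × ξ(y) dy`. [folklore] -/
theorem curl_annularKernelDeriv_convolution_eq (hξ : Continuous ξ) (a x : EuclideanSpace ℝ (Fin 3)) :
    curl (annularKernelDeriv a ⋆[lsmul ℝ ℝ, volume] ξ) x =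
      ∫ y, cross (gradient (annularKernelDeriv a) (x - y)) (ξ y) :=
  curl_convolution_lsmul_eq_integral_cross_of_locallyIntegrable (contDiff_annularKernelDeriv a (n := 1))
    (hasCompactSupport_annularKernelDeriv a) hξ.locallyIntegrable x

/-- `∂ₐ(k ⋆ ξ) = (∂ₐk) ⋆ ξ` as functions. [folklore] -/
theorem fderiv_annularKernel_convolution_apply_eq (hξ : Continuous ξ) (a : EuclideanSpace ℝ (Fin 3)) :
    (fun z => fderiv ℝ (annularKernel ⋆[lsmul ℝ ℝ, volume] ξ) z a) =
      annularKernelDeriv a ⋆[lsmul ℝ ℝ, volume] ξ :=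
  funext fun z => fderiv_convolution_lsmul_apply (contDiff_annularKernel (n := 1))
    hasCompactSupport_annularKernel hξ.locallyIntegrable z a

/-- **`T_{K_a} ξ = (∂ₐφ) curl A_ξ`** everywhere, for `ξ ∈ C^∞` supported in `B̄(0, r)`, `r < 1`
(kernel swap on the shell; both sides vanish off it). [cite: Kwon2023RolePressure, Lemma 2.5 (proof, p. 8)] -/
theorem kernelIntegralOp_commKernelDir (hξ : ContDiff ℝ ∞ ξ) (hr : r < 1)
    (hsupp : tsupport ξ ⊆ closedBall (0 : EuclideanSpace ℝ (Fin 3)) r)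
    (a x : EuclideanSpace ℝ (Fin 3)) :
    kernelIntegralOp (commKernelDir a) ξ x = fderiv ℝ kwonCutoff x a • curl (testPotential ξ) x := by
  have e1 : kernelIntegralOp (commKernelDir a) ξ x =
      fderiv ℝ kwonCutoff x a • ∫ y, cross (gradient annularKernel (x - y)) (ξ y) := by
    rw [kernelIntegralOp, ← integral_smul]
    refine integral_congr_ae (Eventually.of_forall fun y => ?_)
    simp only [commKernelDir, _root_.smul_apply, crossCLM_apply]
  rw [e1]
  by_cases hc : fderiv ℝ kwonCutoff x a = 0
  · rw [hc, zero_smul, zero_smul]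
  · obtain ⟨h1, h2⟩ := shell_of_fderiv_kwonCutoff_ne_zero hc
    rw [curl_testPotential_eq hr hsupp h1 h2, curl_annularKernel_convolution_eq hξ.continuous x]

/-- **`T_{K_Δ} ξ = 2 D(curl A_ξ)(∇φ) + (Δφ) curl A_ξ = W_ξ`** everywhere, for `ξ ∈ C^∞` supported
in `B̄(0, r)`, `r < 1` (kernel swap on the shell: `D(curl A_ξ) = D(curl(k ⋆ ξ))` there,
`∂ᵢ curl(k ⋆ ξ) = curl(∂ᵢk ⋆ ξ)`; both sides vanish off the shell). [cite: Kwon2023RolePressure, (err.Deu)] -/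
theorem kernelIntegralOp_commKernelLap (hξ : ContDiff ℝ ∞ ξ) (hr : r < 1)
    (hsupp : tsupport ξ ⊆ closedBall (0 : EuclideanSpace ℝ (Fin 3)) r)
    (x : EuclideanSpace ℝ (Fin 3)) :
    kernelIntegralOp commKernelLap ξ x =
      (2 : ℝ) • fderiv ℝ (curl (testPotential ξ)) x (gradient kwonCutoff x)
        + ((Δ kwonCutoff) x) • curl (testPotential ξ) x := by
  have hξcont : Continuous ξ := hξ.continuous
  have hξc : HasCompactSupport ξ := hasCompactSupport_of_tsupport_subset_closedBall hsupp
  set e : Fin 3 → EuclideanSpace ℝ (Fin 3) := fun i => EuclideanSpace.single i (1 : ℝ) with he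
  set I : EuclideanSpace ℝ (Fin 3) := ∫ y, cross (gradient annularKernel (x - y)) (ξ y) with hI
  set J : Fin 3 → EuclideanSpace ℝ (Fin 3) :=
    fun i => ∫ y, cross (gradient (annularKernelDeriv (e i)) (x - y)) (ξ y) with hJ
  -- integrability of the pieces
  have hint : ∀ g : EuclideanSpace ℝ (Fin 3) → EuclideanSpace ℝ (Fin 3), Continuous g →
      Integrable fun y => cross (g (x - y)) (ξ y) := fun g hg => by
    have hc : Continuous fun y => cross (g (x - y)) (ξ y) :=
      continuous_cross_of (hg.comp (continuous_const.sub continuous_id)) hξcont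
    refine hc.integrable_of_hasCompactSupport (hξc.mono fun y hy h0 => hy ?_)
    show cross (g (x - y)) (ξ y) = 0
    rw [h0]; simp [cross]
  have hgk : Continuous (gradient annularKernel) :=
    (contDiff_gradient_of_contDiff (n := 0) (contDiff_annularKernel (n := 1))).continuous
  have hgki : ∀ i, Continuous (gradient (annularKernelDeriv (e i))) := fun i =>
    (contDiff_gradient_of_contDiff (n := 0) (contDiff_annularKernelDeriv _ (n := 1))).continuous
  -- (1) the kernel operator as a combination of the integrals
  have e1 : kernelIntegralOp commKernelLap ξ x =
      ∑ i, (2 * fderiv ℝ kwonCutoff x (e i)) • J i + ((Δ kwonCutoff) x) • I := by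
    have hfun : (fun y => commKernelLap x y (ξ y)) = fun y =>
        ∑ i, (2 * fderiv ℝ kwonCutoff x (e i)) • cross (gradient (annularKernelDeriv (e i)) (x - y)) (ξ y)
          + ((Δ kwonCutoff) x) • cross (gradient annularKernel (x - y)) (ξ y) := by
      funext y
      simp only [commKernelLap, _root_.add_apply, FunLike.coe_sum,
        Finset.sum_apply, _root_.smul_apply, crossCLM_apply, he]
    have hi1 : ∀ i, Integrable fun y => (2 * fderiv ℝ kwonCutoff x (e i)) •
        cross (gradient (annularKernelDeriv (e i)) (x - y)) (ξ y) := fun i =>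
      (hint _ (hgki i)).smul (2 * fderiv ℝ kwonCutoff x (e i))
    have hi2 : Integrable fun y => ((Δ kwonCutoff) x) • cross (gradient annularKernel (x - y)) (ξ y) :=
      (hint _ hgk).smul ((Δ kwonCutoff) x)
    rw [kernelIntegralOp, hfun, integral_add (integrable_finsetSum _ fun i _ => hi1 i) hi2,
      integral_finsetSum _ (fun i _ => hi1 i), integral_smul]
    simp only [integral_smul, hJ, hI]
  rw [e1]
  by_cases hx : ‖x‖ < 5 / 4 ∨ 7 / 4 < ‖x‖
  · -- off the shell everything vanishes
    have hf : ∀ b, fderiv ℝ kwonCutoff x b = 0 := fun b => by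
      rcases hx with hx | hx
      · exact fderiv_kwonCutoff_eq_zero_of_lt hx b
      · exact fderiv_kwonCutoff_eq_zero_of_gt hx b
    have hg : gradient kwonCutoff x = 0 := by
      rcases hx with hx | hx
      · exact gradient_kwonCutoff_eq_zero_of_lt hx
      · exact gradient_kwonCutoff_eq_zero_of_gt hx
    have hl : (Δ kwonCutoff) x = 0 := by
      rcases hx with hx | hx
      · exact laplacian_kwonCutoff_eq_zero_of_lt hx
      · exact laplacian_kwonCutoff_eq_zero_of_gt hx
    simp [hf, hg, hl]
  · -- on the shell: kernel swap
    rw [not_or, not_lt, not_lt] at hx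
    obtain ⟨h1, h2⟩ := hx
    have hev := testPotential_eventuallyEq hr hsupp h1 h2
    have hkξ : ContDiff ℝ 2 (annularKernel ⋆[lsmul ℝ ℝ, volume] ξ) :=
      hasCompactSupport_annularKernel.contDiff_convolution_left _ (contDiff_annularKernel (n := 2))
        hξcont.locallyIntegrable
    have hcurlEv : curl (testPotential ξ) =ᶠ[𝓝 x] curl (annularKernel ⋆[lsmul ℝ ℝ, volume] ξ) :=
      hev.fderiv.mono fun z hz => by rw [curl_eq_curlCLM, curl_eq_curlCLM, hz]
    have hD : fderiv ℝ (curl (testPotential ξ)) x =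
        fderiv ℝ (curl (annularKernel ⋆[lsmul ℝ ℝ, volume] ξ)) x := hcurlEv.fderiv_eq
    have hDi : ∀ i, fderiv ℝ (curl (annularKernel ⋆[lsmul ℝ ℝ, volume] ξ)) x (e i) = J i := fun i => by
      rw [← curl_fderiv_apply hkξ x (e i), fderiv_annularKernel_convolution_apply_eq hξcont (e i),
        curl_annularKernelDeriv_convolution_eq hξcont (e i) x]
    have hcurl : curl (testPotential ξ) x = I := by
      rw [curl_testPotential_eq hr hsupp h1 h2, curl_annularKernel_convolution_eq hξcont x]
    have hgrad : gradient kwonCutoff x = ∑ i, fderiv ℝ kwonCutoff x (e i) • e i :=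
      gradient_eq_sum_fderiv_single kwonCutoff x
    rw [hcurl, hD, hgrad, map_sum, Finset.smul_sum]
    congr 1
    refine Finset.sum_congr rfl fun i _ => ?_
    rw [map_smul, hDi i, smul_smul]

/-- **The `∂ₐ`-commutator term transposed onto the test field**: for `u ∈ L¹`,
`∫ ⟪u, curl((∂ₐφ) curl A_ξ)⟫ dx = ∫ ⟪T'_{K_a} u, ξ⟫ dy`. [cite: Kwon2023RolePressure, Lemma 2.5 (proof, p. 8)] -/
theorem integral_inner_curl_commDir (hu : Integrable u) (hξ : ContDiff ℝ ∞ ξ) (hr : r < 1)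
    (hsupp : tsupport ξ ⊆ closedBall (0 : EuclideanSpace ℝ (Fin 3)) r) (a : EuclideanSpace ℝ (Fin 3)) :
    ∫ x, ⟪u x, curl (fun y => fderiv ℝ kwonCutoff y a • curl (testPotential ξ) y) x⟫ =
      ∫ y, ⟪curlKernelTranspose (commKernelDir a) u y, ξ y⟫ := by
  have e : (fun y => fderiv ℝ kwonCutoff y a • curl (testPotential ξ) y) =
      kernelIntegralOp (commKernelDir a) ξ :=
    funext fun y => (kernelIntegralOp_commKernelDir hξ hr hsupp a y).symm
  rw [e]
  exact integral_inner_curl_kernelIntegralOp (contDiff_uncurry_commKernelDir a)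
    (hasCompactSupport_uncurry_commKernelDir a) hu hξ.continuous
    (hasCompactSupport_of_tsupport_subset_closedBall hsupp)

/-- **The `Δ`-commutator term transposed onto the test field**: for `u ∈ L¹`,
`∫ ⟪u, curl W_ξ⟫ dx = ∫ ⟪T'_{K_Δ} u, ξ⟫ dy`, `W_ξ = 2 D(curl A_ξ)(∇φ) + (Δφ) curl A_ξ`
(Kwon's `⟨2 curl Δ⁻¹ div(curl u ⊗ ∇φ) − curl Δ⁻¹(Δφ curl u), ξ⟩` read on the test side).
[cite: Kwon2023RolePressure, (err.Deu)] -/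
theorem integral_inner_curl_commLap (hu : Integrable u) (hξ : ContDiff ℝ ∞ ξ) (hr : r < 1)
    (hsupp : tsupport ξ ⊆ closedBall (0 : EuclideanSpace ℝ (Fin 3)) r) :
    ∫ x, ⟪u x, curl (fun y => (2 : ℝ) • fderiv ℝ (curl (testPotential ξ)) y (gradient kwonCutoff y)
        + ((Δ kwonCutoff) y) • curl (testPotential ξ) y) x⟫ =
      ∫ y, ⟪curlKernelTranspose commKernelLap u y, ξ y⟫ := by
  have e : (fun y => (2 : ℝ) • fderiv ℝ (curl (testPotential ξ)) y (gradient kwonCutoff y)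
      + ((Δ kwonCutoff) y) • curl (testPotential ξ) y) = kernelIntegralOp commKernelLap ξ :=
    funext fun y => (kernelIntegralOp_commKernelLap hξ hr hsupp y).symm
  rw [e]
  exact integral_inner_curl_kernelIntegralOp contDiff_uncurry_commKernelLap
    hasCompactSupport_uncurry_commKernelLap hu hξ.continuous
    (hasCompactSupport_of_tsupport_subset_closedBall hsupp)

/-- The `∂ₐ`-commutator term vanishes off the shell (so its pairing with a slice only sees
`B₂`). [folklore] -/
theorem curl_commDir_eq_zero_of_not_shell (hξ : ContDiff ℝ ∞ ξ) (hr : r < 1)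
    (hsupp : tsupport ξ ⊆ closedBall (0 : EuclideanSpace ℝ (Fin 3)) r) (a : EuclideanSpace ℝ (Fin 3))
    {x : EuclideanSpace ℝ (Fin 3)} (hx : ‖x‖ < 5 / 4 ∨ 7 / 4 < ‖x‖) :
    curl (fun y => fderiv ℝ kwonCutoff y a • curl (testPotential ξ) y) x = 0 := by
  have e : (fun y => fderiv ℝ kwonCutoff y a • curl (testPotential ξ) y) =
      kernelIntegralOp (commKernelDir a) ξ :=
    funext fun y => (kernelIntegralOp_commKernelDir hξ hr hsupp a y).symm
  rw [e]
  exact curl_kernelIntegralOp_eq_zero (contDiff_uncurry_commKernelDir a)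
    (hasCompactSupport_uncurry_commKernelDir a) hξ.continuous
    (hasCompactSupport_of_tsupport_subset_closedBall hsupp) (notMem_tsupport_commKernelDir a hx)

/-- The `Δ`-commutator term vanishes off the shell. [folklore] -/
theorem curl_commLap_eq_zero_of_not_shell (hξ : ContDiff ℝ ∞ ξ) (hr : r < 1)
    (hsupp : tsupport ξ ⊆ closedBall (0 : EuclideanSpace ℝ (Fin 3)) r)
    {x : EuclideanSpace ℝ (Fin 3)} (hx : ‖x‖ < 5 / 4 ∨ 7 / 4 < ‖x‖) :
    curl (fun y => (2 : ℝ) • fderiv ℝ (curl (testPotential ξ)) y (gradient kwonCutoff y)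
        + ((Δ kwonCutoff) y) • curl (testPotential ξ) y) x = 0 := by
  have e : (fun y => (2 : ℝ) • fderiv ℝ (curl (testPotential ξ)) y (gradient kwonCutoff y)
      + ((Δ kwonCutoff) y) • curl (testPotential ξ) y) = kernelIntegralOp commKernelLap ξ :=
    funext fun y => (kernelIntegralOp_commKernelLap hξ hr hsupp y).symm
  rw [e]
  exact curl_kernelIntegralOp_eq_zero contDiff_uncurry_commKernelLap
    hasCompactSupport_uncurry_commKernelLap hξ.continuous
    (hasCompactSupport_of_tsupport_subset_closedBall hsupp) (notMem_tsupport_commKernelLap hx)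

end Identification

end Kwon2023

end Literature.Analysis.FluidPDE

end
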